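import Summits.HubbardSuperconductivity.HubbardSuperconductivity.Theorems.LevyLogBootstrapBlock2InfDivXXZAxisLogConvex
import HarnessLib

/-!
# Crux `Block2InfDivXXZ` (stmt-HubbardSuperconductivity-15048, route `LevyLogBootstrap`):
# the block kernel is a Gram kernel — `k₂(X) ≤ k₂(0)`

Support file. The transverse kernel of any vector `ψ` is a Gram kernel,
`⟨ψ, S⁺_x S⁻_y ψ⟩ = ⟨S⁻_x ψ, S⁻_y ψ⟩` (`S⁺ = (S⁻)†`), so the 2×2-block kernel is the Gram kernel of the
block vectors `u_X = Σ_{x' ∈ block X} S⁻_{x'} ψ`, and Cauchy–Schwarz bounds it by its diagonal. For a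
normalised `S^z_tot = 0` sector ground state the diagonal is constant (translation invariance), whence
(**`coarseKernel_le_coarseKernel_zero(_all)`**, registered sub-goal): the coarse block kernel of the crux
satisfies `k₂(X) ≤ k₂(0)` for every coarse `X`, every real `Δ`, even `M` — its maximum is at the
origin. With `coarseKernel_axis_antitone` (sibling file `…AxisMonotone.lean`) this completes the
monotone shape of the block kernel along a coarse axis from `0` to a quarter of the torus.
Elementary; [folklore]. No definition is introduced; sorry-free.
-/

noncomputable section

set_option linter.dupNamespace false

namespace Summit.HubbardSuperconductivity.HubbardSuperconductivity.Theorems.LevyLogBootstrap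

open scoped BigOperators Matrix ComplexOrder ComplexConjugate
open Matrix Finset Complex
open Literature.MathematicalPhysics.QuantumLattice Literature.Probability.LatticeModels
open Literature.Analysis.Matrix

/-! ### The transverse kernel as a Gram kernel -/

section Gram

variable {Λ : Type*} [Fintype Λ] [DecidableEq Λ]

/-- **`⟨ψ, S⁺_x S⁻_y ψ⟩ = ⟨S⁻_x ψ, S⁻_y ψ⟩`** for every vector `ψ` (`(S⁻_x)† = S⁺_x`, `onSite` is a
`*`-map). Tasaki (2020) §2.2. [folklore] -/
theorem expect_raiseLower_eq_star_dotProduct (ψ : TensorIndex Λ 2 → ℂ) (x y : Λ) :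
    star ψ ⬝ᵥ (onSite x (spinRaise 1) * onSite y (spinLower 1)) *ᵥ ψ =
      star (onSite x (spinLower 1) *ᵥ ψ) ⬝ᵥ (onSite y (spinLower 1) *ᵥ ψ) := by
  have hadj : (onSite x (spinLower 1) : Op Λ 2)ᴴ = onSite x (spinRaise 1) := by
    rw [← onSite_conjTranspose, spinLower_eq_conjTranspose, conjTranspose_conjTranspose]
  rw [star_mulVec, ← dotProduct_mulVec, mulVec_mulVec, hadj]

/-- Real part of a Gram form with real weights: for real `c, d` and vectors `v_i`,
`Re Σ_{i,j} c_i d_j ⟨v_i, v_j⟩ = Re ⟨Σ_i c_i v_i, Σ_j d_j v_j⟩`. [folklore] -/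
theorem sum_sum_mul_mul_star_dotProduct {ι N : Type*} [Fintype ι] [Fintype N] (c d : ι → ℝ)
    (v : ι → N → ℂ) :
    ∑ i, ∑ j, ((c i : ℝ) : ℂ) * ((d j : ℝ) : ℂ) * (star (v i) ⬝ᵥ v j) =
      star (∑ i, ((c i : ℝ) : ℂ) • v i) ⬝ᵥ (∑ j, ((d j : ℝ) : ℂ) • v j) := by
  rw [star_sum, sum_dotProduct]
  refine Finset.sum_congr rfl fun i _ => ?_
  rw [dotProduct_sum]
  refine Finset.sum_congr rfl fun j _ => ?_
  rw [star_smul, dotProduct_smul, smul_dotProduct, Complex.star_def, Complex.conj_ofReal, smul_eq_mul,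
    smul_eq_mul]
  ring

/-- **Cauchy–Schwarz for the dot product with `star`**: `|⟨u, v⟩|² ≤ Re⟨u, u⟩ · Re⟨v, v⟩`
(the Gram matrix of `u, v` is positive semidefinite). [folklore] -/
theorem normSq_star_dotProduct_le {N : Type*} [Fintype N] (u v : N → ℂ) :
    Complex.normSq (star u ⬝ᵥ v) ≤ (star u ⬝ᵥ u).re * (star v ⬝ᵥ v).re := by
  set B : Matrix N (Fin 2) ℂ := Matrix.of fun k i => (![u, v] : Fin 2 → N → ℂ) i k with hB
  have hG : (Bᴴ * B).PosSemidef := posSemidef_conjTranspose_mul_self B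
  have hentry : ∀ i j : Fin 2, (Bᴴ * B) i j =
      star ((![u, v] : Fin 2 → N → ℂ) i) ⬝ᵥ (![u, v] : Fin 2 → N → ℂ) j := by
    intro i j
    rw [Matrix.mul_apply, dotProduct]
    refine Finset.sum_congr rfl fun k _ => ?_
    rw [conjTranspose_apply, hB]
    rfl
  have h := Matrix.normSq_apply_le_of_posSemidef_fin_two hG
  rw [hentry, hentry, hentry] at h
  simpa using h

/-- `Re⟨u, v⟩ ≤ √(Re⟨u,u⟩) √(Re⟨v,v⟩)`, so `Re⟨u, v⟩ ≤ Re⟨v, v⟩` when the two norms agree: the real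
part of a Gram entry is at most the (common) diagonal. [folklore] -/
theorem re_star_dotProduct_le_of_diag_eq {N : Type*} [Fintype N] (u v : N → ℂ)
    (h : (star u ⬝ᵥ u).re = (star v ⬝ᵥ v).re) :
    (star u ⬝ᵥ v).re ≤ (star v ⬝ᵥ v).re := by
  have hcs := normSq_star_dotProduct_le u v
  rw [h] at hcs
  have hnn : 0 ≤ (star v ⬝ᵥ v).re := by
    have : (0 : ℂ) ≤ star v ⬝ᵥ v := dotProduct_star_self_nonneg v
    exact (Complex.le_def.1 this).1
  have hre : (star u ⬝ᵥ v).re ^ 2 ≤ Complex.normSq (star u ⬝ᵥ v) := by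
    rw [Complex.normSq_apply]
    nlinarith [sq_nonneg (star u ⬝ᵥ v).im]
  nlinarith [hcs, hre, hnn, sq_nonneg ((star u ⬝ᵥ v).re - (star v ⬝ᵥ v).re)]

end Gram

/-! ### The coarse block kernel is bounded by its value at the origin -/

section Block

variable (M : ℕ) {m : ℕ} [NeZero M] [NeZero m]

omit [NeZero m] in
/-- The coarse block kernel as the real part of a Gram entry of block vectors:
`Σ_{βx'=X, βy'=Y} Re⟨ψ, S⁺_{x'} S⁻_{y'} ψ⟩ = Re ⟨u_X, u_Y⟩`, `u_X = Σ_{βx'=X} S⁻_{x'} ψ`. [folklore] -/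
theorem blockSum_eq_re_star_dotProduct (ψ : TensorIndex (TorusSite 2 M) 2 → ℂ) (X Y : TorusSite 2 m) :
    (∑ x' : TorusSite 2 M, ∑ y' : TorusSite 2 M,
      if (∀ i : Fin 2, (x' i).val / 2 = (X i).val) ∧ (∀ i : Fin 2, (y' i).val / 2 = (Y i).val) then
        (star ψ ⬝ᵥ Matrix.mulVec (onSite x' (spinRaise 1) * onSite y' (spinLower 1)) ψ).re
      else 0) =
    (star (∑ x' : TorusSite 2 M, ((if (∀ i : Fin 2, (x' i).val / 2 = (X i).val) then (1 : ℝ) else 0 : ℝ) : ℂ) •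
        (onSite x' (spinLower 1) *ᵥ ψ)) ⬝ᵥ
      (∑ y' : TorusSite 2 M, ((if (∀ i : Fin 2, (y' i).val / 2 = (Y i).val) then (1 : ℝ) else 0 : ℝ) : ℂ) •
        (onSite y' (spinLower 1) *ᵥ ψ))).re := by
  classical
  rw [← sum_sum_mul_mul_star_dotProduct, Complex.re_sum]
  refine Finset.sum_congr rfl fun x' _ => ?_
  rw [Complex.re_sum]
  refine Finset.sum_congr rfl fun y' _ => ?_
  rw [← expect_raiseLower_eq_star_dotProduct]
  by_cases hx : ∀ i : Fin 2, (x' i).val / 2 = (X i).val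
  · by_cases hy : ∀ i : Fin 2, (y' i).val / 2 = (Y i).val
    · rw [if_pos ⟨hx, hy⟩, if_pos hx, if_pos hy]
      simp
    · rw [if_neg (fun h => hy h.2), if_neg hy]
      simp
  · rw [if_neg (fun h => hx h.1), if_neg hx]
    simp

/-- Real form of the block shift `Σ_{x' ∈ block X} g(x') = Σ_{δ ∈ block 0} g(δ + 2X)`
(`TorusBlock.sum_ite_block_eq_sum_ite_block_zero`). [folklore] -/
theorem sum_ite_block_shift_real (hM : M = 2 * m) (g : TorusSite 2 M → ℝ) (X : TorusSite 2 m) :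
    ∑ x' : TorusSite 2 M, (if (∀ i : Fin 2, (x' i).val / 2 = (X i).val) then g x' else 0) =
      ∑ δ : TorusSite 2 M, (if (∀ i : Fin 2, (δ i).val / 2 = 0) then
        g (δ + fun j => ((2 * (X j).val : ℕ) : ZMod M)) else 0) := by
  have h := TorusBlock.sum_ite_block_eq_sum_ite_block_zero (d := 2) (b := 2) hM
    (fun x => ((g x : ℝ) : ℂ)) X
  simp_rw [ite_eq_re_ite_ofReal]
  rw [← Complex.re_sum, ← Complex.re_sum]
  exact congrArg Complex.re h

/-- The diagonal block sums of a sector ground state are all equal to the origin one: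
`Σ_{βx'=X, βy'=X} K(x',y') = Σ_{βx'=0, βy'=0} K(x',y')` (shift both blocks by `2X`; translation
invariance of the ground-state kernel). [folklore] -/
theorem blockSum_diag_eq_zero (hM : M = 2 * m) (hEven : Even M) (Δ : ℝ)
    (ψ : TensorIndex (TorusSite 2 M) 2 → ℂ)
    (hψ : ψ ∈ @spinZSector (TorusSite 2 M) _ _ 1 0) (hnorm : star ψ ⬝ᵥ ψ = 1)
    (heig : Matrix.mulVec (xxzHamiltonian 1 (torusGraph 2 M) (-1) Δ) ψ =
      ((lowestEnergyInSector 1 (xxzHamiltonian 1 (torusGraph 2 M) (-1) Δ) 0 : ℝ) : ℂ) • ψ)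
    (X : TorusSite 2 m) :
    (∑ x' : TorusSite 2 M, ∑ y' : TorusSite 2 M,
      if (∀ i : Fin 2, (x' i).val / 2 = (X i).val) ∧ (∀ i : Fin 2, (y' i).val / 2 = (X i).val) then
        (star ψ ⬝ᵥ Matrix.mulVec (onSite x' (spinRaise 1) * onSite y' (spinLower 1)) ψ).re
      else 0) =
    ∑ x' : TorusSite 2 M, ∑ y' : TorusSite 2 M,
      if (∀ i : Fin 2, (x' i).val / 2 = 0) ∧ (∀ i : Fin 2, (y' i).val / 2 = 0) then
        (star ψ ⬝ᵥ Matrix.mulVec (onSite x' (spinRaise 1) * onSite y' (spinLower 1)) ψ).re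
      else 0 := by
  classical
  set w : TorusSite 2 M := fun j => ((2 * (X j).val : ℕ) : ZMod M) with hw
  set K : TorusSite 2 M → TorusSite 2 M → ℝ := fun x' y' =>
    (star ψ ⬝ᵥ Matrix.mulVec (onSite x' (spinRaise 1) * onSite y' (spinLower 1)) ψ).re with hK
  have hT : ∀ γ δ : TorusSite 2 M, K (γ + w) (δ + w) = K γ δ :=
    fun γ δ => gs_transverseKernel_translate M hEven Δ ψ hψ hnorm heig w γ δ
  show (∑ x' : TorusSite 2 M, ∑ y' : TorusSite 2 M,
      if (∀ i : Fin 2, (x' i).val / 2 = (X i).val) ∧ (∀ i : Fin 2, (y' i).val / 2 = (X i).val) then K x' y'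
      else 0) = ∑ x' : TorusSite 2 M, ∑ y' : TorusSite 2 M,
      if (∀ i : Fin 2, (x' i).val / 2 = 0) ∧ (∀ i : Fin 2, (y' i).val / 2 = 0) then K x' y' else 0
  simp only [ite_and, Finset.sum_ite_irrel, Finset.sum_const_zero]
  -- inner shift, then outer shift
  have hy : ∀ x' : TorusSite 2 M, (∑ y' : TorusSite 2 M,
      if (∀ i : Fin 2, (y' i).val / 2 = (X i).val) then K x' y' else 0) =
        ∑ δ : TorusSite 2 M, if (∀ i : Fin 2, (δ i).val / 2 = 0) then K x' (δ + w) else 0 :=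
    fun x' => sum_ite_block_shift_real M hM (fun y' => K x' y') X
  simp_rw [hy]
  have hx := sum_ite_block_shift_real M hM
    (fun x' => ∑ δ : TorusSite 2 M, if (∀ i : Fin 2, (δ i).val / 2 = 0) then K x' (δ + w) else 0) X
  rw [hx]
  simp only [← hw, hT]

/-- **The coarse block kernel is maximal at the origin**: for even `M = 2m`, every real `Δ`, every
normalised `S^z_tot = 0` sector ground state `ψ` and every coarse `X`, `k₂(X) ≤ k₂(0)`
(Gram/Cauchy–Schwarz + translation invariance of the diagonal). [folklore] -/
theorem coarseKernel_le_coarseKernel_zero (hM : M = 2 * m) (hEven : Even M) (Δ : ℝ)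
    (ψ : TensorIndex (TorusSite 2 M) 2 → ℂ)
    (hψ : ψ ∈ @spinZSector (TorusSite 2 M) _ _ 1 0) (hnorm : star ψ ⬝ᵥ ψ = 1)
    (heig : Matrix.mulVec (xxzHamiltonian 1 (torusGraph 2 M) (-1) Δ) ψ =
      ((lowestEnergyInSector 1 (xxzHamiltonian 1 (torusGraph 2 M) (-1) Δ) 0 : ℝ) : ℂ) • ψ)
    (X : TorusSite 2 m) :
    (∑ x' : TorusSite 2 M, ∑ y' : TorusSite 2 M,
      if (∀ i : Fin 2, (x' i).val / 2 = (X i).val) ∧ (∀ i : Fin 2, (y' i).val / 2 = 0) then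
        (star ψ ⬝ᵥ Matrix.mulVec (onSite x' (spinRaise 1) * onSite y' (spinLower 1)) ψ).re
      else 0) ≤
    ∑ x' : TorusSite 2 M, ∑ y' : TorusSite 2 M,
      if (∀ i : Fin 2, (x' i).val / 2 = ((0 : TorusSite 2 m) i).val) ∧ (∀ i : Fin 2, (y' i).val / 2 = 0) then
        (star ψ ⬝ᵥ Matrix.mulVec (onSite x' (spinRaise 1) * onSite y' (spinLower 1)) ψ).re
      else 0 := by
  classical
  have h0 : ∀ y' : TorusSite 2 M, (∀ i : Fin 2, (y' i).val / 2 = 0) ↔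
      (∀ i : Fin 2, (y' i).val / 2 = ((0 : TorusSite 2 m) i).val) := fun y' => by simp
  -- both sides as Gram entries of the block vectors `u_X`, `u_0`
  have hL := blockSum_eq_re_star_dotProduct M ψ X (0 : TorusSite 2 m)
  have hR := blockSum_eq_re_star_dotProduct M ψ (0 : TorusSite 2 m) (0 : TorusSite 2 m)
  have hD := blockSum_eq_re_star_dotProduct M ψ X X
  simp only [Pi.zero_apply, ZMod.val_zero] at hL hR hD ⊢
  rw [hL, hR]
  apply re_star_dotProduct_le_of_diag_eq
  rw [← hD, ← hR]
  exact blockSum_diag_eq_zero M hM hEven Δ ψ hψ hnorm heig X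

/-- **Registered form** (sub-goal `coarseKernel_le_coarseKernel_zero_all`). [folklore] -/
theorem coarseKernel_le_coarseKernel_zero_all :
    ∀ (M m : ℕ) [NeZero M] [NeZero m], M = 2 * m → Even M → ∀ (Δ : ℝ) (ψ : TensorIndex (TorusSite 2
      M) 2 → ℂ), ψ ∈ @spinZSector (TorusSite 2 M) _ _ 1 0 → star ψ ⬝ᵥ ψ = 1 → Matrix.mulVec
      (xxzHamiltonian 1 (torusGraph 2 M) (-1) Δ) ψ = ((lowestEnergyInSector 1 (xxzHamiltonian 1
      (torusGraph 2 M) (-1) Δ) 0 : ℝ) : ℂ) • ψ → ∀ (X : TorusSite 2 m), (∑ x' : TorusSite 2 M, ∑ y'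
      : TorusSite 2 M, if (∀ i : Fin 2, (x' i).val / 2 = (X i).val) ∧ (∀ i : Fin 2, (y' i).val / 2 =
      0) then (star ψ ⬝ᵥ Matrix.mulVec (onSite x' (spinRaise 1) * onSite y' (spinLower 1)) ψ).re
      else 0) ≤ ∑ x' : TorusSite 2 M, ∑ y' : TorusSite 2 M, if (∀ i : Fin 2, (x' i).val / 2 = ((0 :
      TorusSite 2 m) i).val) ∧ (∀ i : Fin 2, (y' i).val / 2 = 0) then (star ψ ⬝ᵥ Matrix.mulVec
      (onSite x' (spinRaise 1) * onSite y' (spinLower 1)) ψ).re else 0 :=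
  fun M _ _ _ hM hEven Δ ψ hψ hnorm heig X =>
    coarseKernel_le_coarseKernel_zero M hM hEven Δ ψ hψ hnorm heig X

end Block

end Summit.HubbardSuperconductivity.HubbardSuperconductivity.Theorems.LevyLogBootstrap

end
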